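import Summits.BirchSwinnertonDyer.BirchSwinnertonDyer.Theorems.InertBadSignedBranchesPlusMCEtaKCharIdealBaseChange
import Summits.BirchSwinnertonDyer.BirchSwinnertonDyer.Theorems.ErratumRoadFiveCharIdealTransferTorsion
import Summits.BirchSwinnertonDyer.Rank1Residual.X11b.RouteR1IntReceptacle
import Literature.NumberTheory.EllipticCurves.IwasawaAlgebraCharIdealProofs
import Literature.NumberTheory.EllipticCurves.IwasawaAlgebraProofs
import HarnessLib

set_option linter.dupNamespace false -- `Summit.BirchSwinnertonDyer.BirchSwinnertonDyer.Theorems.…` (summit = sub)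
set_option autoImplicit false

/-!
# Crux `EisensteinHeartFlatCMInertBadKPrime` (stmt-BirchSwinnertonDyer-21341), line `hsieh-lambda`, layer 2 (E1c):
# the ALGEBRA of reading `Ch_Λ(X)` in `𝓞_{ℂ_p}⟦T⟧` through the coefficient extension `Λ → Λ_𝒪 = 𝒪⟦T⟧`
# — flat base change of characteristic ideals (CITED), the `𝓞_{ℂ_p}⟦T⟧` reading, and transport along
# `Λ_𝒪`-linear maps with finite kernel and cokernel

Route `BiquadraticEisensteinDescent` (cell `pub/bsd-wall`, width-prover seat `bsd-wall-cm-bed-w1` g0, D-0152 M1), on the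
lead's E1c-ALGEBRA SHAPE (bus 2026-08-28T02:04:00Z; `LAYER2-VOCAB-BRIEF.md` V3). The ♭-heart reads the `Λ = ℤ_p⟦T⟧`-
characteristic ideal of `X = X_ac(W/K′)_{𝔭′-str}` in `𝓞_{ℂ_p}⟦T⟧` along `PowerSeries.map (R1.toCpInt p)`; layer 2 of
the line compares `X ⊗_Λ Λ_𝒪` (`Λ_𝒪 = 𝒪⟦T⟧`, `𝒪` the integers of a finite extension of `ℚ_p`: `W(𝔽_{p²})`, `ℤ_p[ζ]`) with
a CM-side `Λ_𝒪`-module by `Λ_𝒪`-linear maps with finite kernel and cokernel (Shapiro + descent). The three pieces: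

(a) **`Ch_{Λ_𝒪}(Λ_𝒪 ⊗_Λ M) = Ch_Λ(M)·Λ_𝒪`** for `M` finitely generated torsion — this is the TREE THEOREM
`PlusMCEtaKCharIdealBaseChange.iwasawaAlgebra_charIdeal_baseChange_eq_map` (route `InertBadSignedBranches`, road (C),
seat bsd-cm-k8i: flat base change of local lengths, Stacks 02M1, + going-down) — CITED, not re-proved; also its
base-change-datum form `charIdeal_eq_map_of_isBaseChange`.
(b) **the `𝓞_{ℂ_p}⟦T⟧` reading**: for `ι : 𝒪 → 𝓞_{ℂ_p}` extending `R1.toCpInt p : ℤ_p → 𝓞_{ℂ_p}`,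
`Ch_Λ(M)·𝓞_{ℂ_p}⟦T⟧ = Ch_{Λ_𝒪}(Λ_𝒪 ⊗_Λ M)·𝓞_{ℂ_p}⟦T⟧` as ideals of `𝓞_{ℂ_p}⟦T⟧` (`map_toCpInt_charIdeal_eq`, and
`…_of_isBaseChange` for a consumer-held model `N` of `M ⊗ 𝒪`).
(c) **transport**: a finite `Λ_𝒪`-module is pseudo-null (`dim 𝒪⟦T⟧ = 2`, tree `CongruenceLimit.ringKrullDim_powerSeries_eq_two`: `isPseudoNull_of_finite`), so a `Λ_𝒪`-linear
map with finite kernel and cokernel is a pseudo-isomorphism and preserves `Ch_{Λ_𝒪}` (`charIdeal_eq_of_finite_ker_coker`,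
tree `charIdeal_eq_of_arePseudoIsomorphic`); one-sided: a surjection (resp. injection) of finitely generated torsion
modules gives `Ch(source) ⊆ Ch(target)` (resp. `⊇`) by multiplicativity (tree `charIdeal_eq_mul_of_exact`).
(d) **sockets**: (a)+(b)+(c) composed — `Ch_Λ(M)·𝓞_{ℂ_p}⟦T⟧ = Ch_{Λ_𝒪}(N′)·𝓞_{ℂ_p}⟦T⟧` for any `N′` linked to `M ⊗ 𝒪`
by a finite-kernel-finite-cokernel map in either direction, and the corresponding transfers of the heart shape
`∃ m, p^m·I ⊆ (Q)` (the lead's (V3) socket with `m′ = 0`; cf. `…ConstantScaling.heartShape_of_pow_mul_le`).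

THEOREMS ONLY (no definition, no named fact, no `sorry`); imports no `Theses` module; pure commutative algebra over the
tree's `Module.charIdeal` library. Nothing about the crux's input or any case of BSD is asserted; BSD is not proved by
any of this. Supports stmt-BirchSwinnertonDyer-21341 as a helper.

References: [SkinnerUrban2014] §3.1.6, Cor. 3.2.9; [StacksProject] Tags 02M1, 00KD; [Washington1997] §13.2;
[NeukirchSchmidtWingberg2008] (5.1.4) Remark 4, (5.3.9) Remark 2; [PollackRubin2004] proof of Thm. 7.3.
-/

noncomputable section

open scoped TensorProduct

open PowerSeries IsLocalRing
  Literature.NumberTheory.EllipticCurves Literature.NumberTheory.EllipticCurves.Module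
  Summit.BirchSwinnertonDyer.Rank1Residual.X11b
  Summit.BirchSwinnertonDyer.BirchSwinnertonDyer.Theorems

namespace Summit.BirchSwinnertonDyer.BirchSwinnertonDyer.Theorems.BiquadraticEisensteinDescentEisensteinHeartFlatCMInertBadKPrimeCharIdealBaseChange

/-! ## §1 Finite `𝒪⟦T⟧`-modules are pseudo-null (`𝒪` a discrete valuation ring) -/

section PseudoNull

variable {𝒪 : Type} [CommRing 𝒪] [IsDomain 𝒪] [IsDiscreteValuationRing 𝒪]

/-- The maximal ideal `(ϖ, T)` of `𝒪⟦T⟧` has height `2` (`dim 𝒪⟦T⟧ = 2`, tree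
`CongruenceLimit.ringKrullDim_powerSeries_eq_two`). [cite: StacksProject, Tag 00KD] -/
theorem height_maximalIdeal_powerSeries : (maximalIdeal 𝒪⟦X⟧).height = 2 := by
  have h := IsLocalRing.maximalIdeal_height_eq_ringKrullDim (R := 𝒪⟦X⟧)
  rw [CongruenceLimit.ringKrullDim_powerSeries_eq_two 𝒪, show (2 : WithBot ℕ∞) = ((2 : ℕ∞) : WithBot ℕ∞) from rfl,
    WithBot.coe_inj] at h
  exact h

/-- A prime of `𝒪⟦T⟧` of height `≤ 1` is not the maximal ideal. [cite: StacksProject, Tag 00KD] -/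
theorem ne_maximalIdeal_of_height_le_one (𝔮 : Ideal 𝒪⟦X⟧) (h : 𝔮.height ≤ 1) :
    𝔮 ≠ maximalIdeal 𝒪⟦X⟧ := by
  rintro rfl
  rw [height_maximalIdeal_powerSeries] at h
  exact absurd h (by decide)

variable {N : Type*} [AddCommGroup N] [Module 𝒪⟦X⟧ N]

/-- **A finite `Λ_𝒪 = 𝒪⟦T⟧`-module is pseudo-null** (NSW (5.1.4) Remark 4; verbatim the tree's argument for
`Λ = ℤ_p⟦T⟧`, `isPseudoNull_of_finite`): at a prime `𝔭` of height `≤ 1` pick `s ∈ 𝔪 ∖ 𝔭`; for `m ∈ N` pigeonhole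
gives `sⁱm = sʲm` with `i < j`, and `1 − s^{j−i}` is a unit, so `sⁱ m = 0` with `sⁱ ∉ 𝔭`, i.e. `m = 0` in `N_𝔭`.
[cite: NeukirchSchmidtWingberg2008, Ch. V §1, (5.1.4) Remark 4] -/
theorem isPseudoNull_of_finite [Finite N] : Module.IsPseudoNull 𝒪⟦X⟧ N := by
  intro 𝔭 h𝔭
  have hne := ne_maximalIdeal_of_height_le_one 𝔭.asIdeal h𝔭
  have hnot : ¬ maximalIdeal 𝒪⟦X⟧ ≤ 𝔭.asIdeal := fun h =>
    hne ((IsLocalRing.maximalIdeal.isMaximal _).eq_of_le 𝔭.isPrime.ne_top h).symm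
  obtain ⟨s, hs𝔪, hs𝔭⟩ := Set.not_subset.1 hnot
  rw [LocalizedModule.subsingleton_iff]
  intro m
  obtain ⟨i, j, hij, heq⟩ := Finite.exists_ne_map_eq_of_infinite (fun n : ℕ => s ^ n • m)
  wlog hlt : i < j generalizing i j
  · exact this j i hij.symm heq.symm (lt_of_le_of_ne (not_lt.1 hlt) hij.symm)
  refine ⟨s ^ i, fun h => hs𝔭 (𝔭.isPrime.mem_of_pow_mem _ h), ?_⟩
  obtain ⟨k, rfl⟩ := Nat.exists_eq_add_of_lt hlt
  have hu : IsUnit (1 - s ^ (k + 1)) :=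
    isUnit_one_sub_self_of_mem_nonunits _ (Ideal.pow_mem_of_mem _ hs𝔪 _ k.succ_pos)
  have h0 : (1 - s ^ (k + 1)) • (s ^ i • m) = 0 := by
    rw [sub_smul, one_smul, ← mul_smul, ← pow_add, sub_eq_zero]
    rw [heq]
    congr 1
    ring
  exact (hu.smul_eq_zero).1 h0

variable {N' : Type*} [AddCommGroup N'] [Module 𝒪⟦X⟧ N']

/-- **A `Λ_𝒪`-linear map with finite kernel and finite cokernel is a pseudo-isomorphism.**
[cite: NeukirchSchmidtWingberg2008, Ch. V §1, (5.1.4) Remark 4] -/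
theorem arePseudoIsomorphic_of_finite_ker_coker (f : N →ₗ[𝒪⟦X⟧] N') (hk : Finite (LinearMap.ker f))
    (hc : Finite (N' ⧸ LinearMap.range f)) : ArePseudoIsomorphic 𝒪⟦X⟧ N N' := by
  haveI := hk
  haveI := hc
  exact ⟨f, isPseudoNull_of_finite, isPseudoNull_of_finite⟩

/-- **Characteristic ideals over `Λ_𝒪` are invariant along maps with finite kernel and cokernel** (in either
direction, the conclusion being symmetric): tree `charIdeal_eq_of_arePseudoIsomorphic`.
[cite: Washington1997, §13.2] [cite: NeukirchSchmidtWingberg2008, Ch. V §1, (5.1.4) Remark 4] -/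
theorem charIdeal_eq_of_finite_ker_coker (f : N →ₗ[𝒪⟦X⟧] N') (hk : Finite (LinearMap.ker f))
    (hc : Finite (N' ⧸ LinearMap.range f)) : charIdeal 𝒪⟦X⟧ N = charIdeal 𝒪⟦X⟧ N' :=
  charIdeal_eq_of_arePseudoIsomorphic (arePseudoIsomorphic_of_finite_ker_coker f hk hc)

end PseudoNull

/-! ## §2 One-sided transport: surjections and injections of finitely generated torsion modules -/

section OneSided

variable {R : Type*} [CommRing R] [IsNoetherianRing R] [IsDomain R]
  {M M' : Type*} [AddCommGroup M] [Module R M] [AddCommGroup M'] [Module R M']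

/-- **`Ch(M) ⊆ Ch(M″)` along a surjection `M ↠ M″`** of a finitely generated torsion module over a Noetherian domain:
`Ch(M) = Ch(ker)·Ch(M″)` (tree `charIdeal_eq_mul_of_exact`). [cite: NeukirchSchmidtWingberg2008, Ch. V §3, Remark 2 after (5.3.9)] -/
theorem charIdeal_le_of_surjective [Module.Finite R M] (hM : Module.IsTorsion R M) (g : M →ₗ[R] M')
    (hg : Function.Surjective g) : charIdeal R M ≤ charIdeal R M' := by
  rw [charIdeal_eq_mul_of_exact hM (LinearMap.ker g).subtype g (Submodule.subtype_injective _) hg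
    (LinearMap.exact_subtype_ker_map g)]
  exact Ideal.mul_le_left

/-- **`Ch(M) ⊆ Ch(M′)` along an injection `M′ ↪ M`** into a finitely generated torsion module over a Noetherian
domain: `Ch(M) = Ch(M′)·Ch(coker)`. [cite: NeukirchSchmidtWingberg2008, Ch. V §3, Remark 2 after (5.3.9)] -/
theorem charIdeal_le_of_injective [Module.Finite R M] (hM : Module.IsTorsion R M) (f : M' →ₗ[R] M)
    (hf : Function.Injective f) : charIdeal R M ≤ charIdeal R M' := by
  rw [charIdeal_eq_mul_of_exact hM f (LinearMap.range f).mkQ hf (Submodule.mkQ_surjective _)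
    (LinearMap.exact_map_mkQ_range f)]
  exact Ideal.mul_le_right

end OneSided

/-! ## §3 The `𝓞_{ℂ_p}⟦T⟧` reading of `Ch_Λ` through `Λ → Λ_𝒪 = 𝒪⟦T⟧` -/

section Reading

variable {p : ℕ} [Fact p.Prime] {𝒪 : Type} [CommRing 𝒪] [IsDomain 𝒪] [IsDiscreteValuationRing 𝒪]
  [Algebra ℤ_[p] 𝒪] [Module.Free ℤ_[p] 𝒪] [Module.Finite ℤ_[p] 𝒪]

omit [IsDomain 𝒪] [IsDiscreteValuationRing 𝒪] [Module.Free ℤ_[p] 𝒪] [Module.Finite ℤ_[p] 𝒪] in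
/-- Coefficient maps compose: for `ι : 𝒪 → 𝓞_{ℂ_p}` extending `ℤ_p → 𝓞_{ℂ_p}`,
`(𝒪⟦T⟧ → 𝓞_{ℂ_p}⟦T⟧) ∘ (Λ → 𝒪⟦T⟧) = (Λ → 𝓞_{ℂ_p}⟦T⟧)`. [folklore] -/
theorem map_comp_algebraMap_eq (ι : 𝒪 →+* 𝓞_ℂ_[p]) (hι : ι.comp (algebraMap ℤ_[p] 𝒪) = R1.toCpInt p) :
    (PowerSeries.map ι).comp (algebraMap (IwasawaAlgebra p) 𝒪⟦X⟧) = PowerSeries.map (R1.toCpInt p) := by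
  rw [← hι, PowerSeries.map_comp]
  rfl

variable (ι : 𝒪 →+* 𝓞_ℂ_[p]) (hι : ι.comp (algebraMap ℤ_[p] 𝒪) = R1.toCpInt p)
  (M : Type*) [AddCommGroup M] [Module (IwasawaAlgebra p) M] [Module.Finite (IwasawaAlgebra p) M]

include hι

/-- **(b) The `𝓞_{ℂ_p}⟦T⟧` reading of `Ch_Λ(M)` is that of `Ch_{Λ_𝒪}(Λ_𝒪 ⊗_Λ M)`**: for a finitely generated torsion
`Λ`-module `M` and `ι : 𝒪 → 𝓞_{ℂ_p}` over `ℤ_p → 𝓞_{ℂ_p}`,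
`Ch_Λ(M)·𝓞_{ℂ_p}⟦T⟧ = Ch_{𝒪⟦T⟧}(𝒪⟦T⟧ ⊗_Λ M)·𝓞_{ℂ_p}⟦T⟧` — the tree's flat base change
`PlusMCEtaKCharIdealBaseChange.iwasawaAlgebra_charIdeal_baseChange_eq_map` pushed along `ι`.
[cite: SkinnerUrban2014, §3.1.6 (p. 20)] [cite: StacksProject, Tag 02M1] -/
theorem map_toCpInt_charIdeal_eq (hM : Module.IsTorsion (IwasawaAlgebra p) M) :
    (charIdeal (IwasawaAlgebra p) M).map (PowerSeries.map (R1.toCpInt p)) =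
      (charIdeal 𝒪⟦X⟧ (𝒪⟦X⟧ ⊗[IwasawaAlgebra p] M)).map (PowerSeries.map ι) := by
  rw [PlusMCEtaKCharIdealBaseChange.iwasawaAlgebra_charIdeal_baseChange_eq_map M hM, Ideal.map_map,
    map_comp_algebraMap_eq ι hι]

variable {N : Type*} [AddCommGroup N] [Module (IwasawaAlgebra p) N] [Module 𝒪⟦X⟧ N]
  [IsScalarTower (IwasawaAlgebra p) 𝒪⟦X⟧ N]

/-- **(b), base-change-datum form**: the same for a consumer-held model `N` of `M ⊗_Λ 𝒪⟦T⟧`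
(`IsBaseChange 𝒪⟦T⟧ f`, `f : M → N`): `Ch_Λ(M)·𝓞_{ℂ_p}⟦T⟧ = Ch_{𝒪⟦T⟧}(N)·𝓞_{ℂ_p}⟦T⟧`.
[cite: SkinnerUrban2014, §3.1.6 (p. 20)] [cite: StacksProject, Tag 02M1] -/
theorem map_toCpInt_charIdeal_eq_of_isBaseChange (hM : Module.IsTorsion (IwasawaAlgebra p) M)
    {f : M →ₗ[IwasawaAlgebra p] N} (hf : IsBaseChange 𝒪⟦X⟧ f) :
    (charIdeal (IwasawaAlgebra p) M).map (PowerSeries.map (R1.toCpInt p)) =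
      (charIdeal 𝒪⟦X⟧ N).map (PowerSeries.map ι) := by
  haveI : Module.Free (IwasawaAlgebra p) 𝒪⟦X⟧ := PlusMCEtaKBaseChange.free_powerSeries
  haveI : Module.Finite (IwasawaAlgebra p) 𝒪⟦X⟧ := PlusMCEtaKBaseChange.finite_powerSeries
  rw [PlusMCEtaKCharIdealBaseChange.charIdeal_eq_map_of_isBaseChange hM hf, Ideal.map_map,
    map_comp_algebraMap_eq ι hι]

/-! ## §4 Sockets: (a)+(b)+(c) composed, and the heart shape -/

variable {N' : Type*} [AddCommGroup N'] [Module 𝒪⟦X⟧ N']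

/-- **Socket (equality form, map towards the CM side)**: if `N ≅ M ⊗_Λ 𝒪⟦T⟧` (`IsBaseChange`) maps to `N′` by a
`𝒪⟦T⟧`-linear map with finite kernel and cokernel, then `Ch_Λ(M)·𝓞_{ℂ_p}⟦T⟧ = Ch_{𝒪⟦T⟧}(N′)·𝓞_{ℂ_p}⟦T⟧`.
[cite: Washington1997, §13.2] [cite: StacksProject, Tag 02M1] -/
theorem map_toCpInt_charIdeal_eq_of_finite_ker_coker (hM : Module.IsTorsion (IwasawaAlgebra p) M)
    {f : M →ₗ[IwasawaAlgebra p] N} (hf : IsBaseChange 𝒪⟦X⟧ f) (g : N →ₗ[𝒪⟦X⟧] N')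
    (hk : Finite (LinearMap.ker g)) (hc : Finite (N' ⧸ LinearMap.range g)) :
    (charIdeal (IwasawaAlgebra p) M).map (PowerSeries.map (R1.toCpInt p)) =
      (charIdeal 𝒪⟦X⟧ N').map (PowerSeries.map ι) := by
  rw [map_toCpInt_charIdeal_eq_of_isBaseChange ι hι M hM hf, charIdeal_eq_of_finite_ker_coker g hk hc]

/-- **Socket (equality form, map from the CM side)**: the same with the finite-kernel-finite-cokernel map
`g′ : N′ → N` in the other direction. [cite: Washington1997, §13.2] [cite: StacksProject, Tag 02M1] -/
theorem map_toCpInt_charIdeal_eq_of_finite_ker_coker' (hM : Module.IsTorsion (IwasawaAlgebra p) M)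
    {f : M →ₗ[IwasawaAlgebra p] N} (hf : IsBaseChange 𝒪⟦X⟧ f) (g' : N' →ₗ[𝒪⟦X⟧] N)
    (hk : Finite (LinearMap.ker g')) (hc : Finite (N ⧸ LinearMap.range g')) :
    (charIdeal (IwasawaAlgebra p) M).map (PowerSeries.map (R1.toCpInt p)) =
      (charIdeal 𝒪⟦X⟧ N').map (PowerSeries.map ι) := by
  rw [map_toCpInt_charIdeal_eq_of_isBaseChange ι hι M hM hf, charIdeal_eq_of_finite_ker_coker g' hk hc]

/-- **Socket (one-sided form)**: if `N ≅ M ⊗_Λ 𝒪⟦T⟧` is finitely generated torsion over `𝒪⟦T⟧` and SURJECTS onto `N′`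
(any kernel), then `Ch_Λ(M)·𝓞_{ℂ_p}⟦T⟧ ⊆ Ch_{𝒪⟦T⟧}(N′)·𝓞_{ℂ_p}⟦T⟧` — the inclusion the heart's (V3) socket consumes
with `m′ = 0`. [cite: NeukirchSchmidtWingberg2008, Ch. V §3, Remark 2 after (5.3.9)] [cite: StacksProject, Tag 02M1] -/
theorem map_toCpInt_charIdeal_le_of_surjective (hM : Module.IsTorsion (IwasawaAlgebra p) M)
    {f : M →ₗ[IwasawaAlgebra p] N} (hf : IsBaseChange 𝒪⟦X⟧ f) [Module.Finite 𝒪⟦X⟧ N]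
    (hN : Module.IsTorsion 𝒪⟦X⟧ N) (g : N →ₗ[𝒪⟦X⟧] N') (hg : Function.Surjective g) :
    (charIdeal (IwasawaAlgebra p) M).map (PowerSeries.map (R1.toCpInt p)) ≤
      (charIdeal 𝒪⟦X⟧ N').map (PowerSeries.map ι) := by
  rw [map_toCpInt_charIdeal_eq_of_isBaseChange ι hι M hM hf]
  exact Ideal.map_mono (charIdeal_le_of_surjective hN g hg)

omit hι in
/-- **Heart shape is inherited by smaller ideals**: if `I ⊆ J` (ideals of `𝓞_{ℂ_p}⟦T⟧`) and `∃ m, p^m·J ⊆ (Q)` then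
`∃ m, p^m·I ⊆ (Q)`. [folklore] -/
theorem heartShape_of_le {I J : Ideal (PowerSeries 𝓞_ℂ_[p])} (hIJ : I ≤ J) {Q : PowerSeries 𝓞_ℂ_[p]}
    (hJ : ∃ m : ℕ, ∀ x ∈ J, (C ((p : ℕ) : 𝓞_ℂ_[p]) : PowerSeries 𝓞_ℂ_[p]) ^ m * x ∈ Ideal.span {Q}) :
    ∃ m : ℕ, ∀ x ∈ I, (C ((p : ℕ) : 𝓞_ℂ_[p]) : PowerSeries 𝓞_ℂ_[p]) ^ m * x ∈ Ideal.span {Q} := by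
  obtain ⟨m, hm⟩ := hJ
  exact ⟨m, fun x hx ↦ hm x (hIJ hx)⟩

/-- **The heart shape transfers from the CM side to `Ch_Λ(M)`** along base change + a finite-kernel-finite-cokernel map
`N → N′`: if `∃ m, p^m·Ch_{𝒪⟦T⟧}(N′)·𝓞_{ℂ_p}⟦T⟧ ⊆ (Q)` then `∃ m, p^m·Ch_Λ(M)·𝓞_{ℂ_p}⟦T⟧ ⊆ (Q)` (same `m`).
[cite: Washington1997, §13.2] [cite: StacksProject, Tag 02M1] -/
theorem heartShape_of_finite_ker_coker (hM : Module.IsTorsion (IwasawaAlgebra p) M)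
    {f : M →ₗ[IwasawaAlgebra p] N} (hf : IsBaseChange 𝒪⟦X⟧ f) (g : N →ₗ[𝒪⟦X⟧] N')
    (hk : Finite (LinearMap.ker g)) (hc : Finite (N' ⧸ LinearMap.range g)) {Q : PowerSeries 𝓞_ℂ_[p]}
    (hN' : ∃ m : ℕ, ∀ x ∈ (charIdeal 𝒪⟦X⟧ N').map (PowerSeries.map ι),
      (C ((p : ℕ) : 𝓞_ℂ_[p]) : PowerSeries 𝓞_ℂ_[p]) ^ m * x ∈ Ideal.span {Q}) :
    ∃ m : ℕ, ∀ x ∈ (charIdeal (IwasawaAlgebra p) M).map (PowerSeries.map (R1.toCpInt p)),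
      (C ((p : ℕ) : 𝓞_ℂ_[p]) : PowerSeries 𝓞_ℂ_[p]) ^ m * x ∈ Ideal.span {Q} := by
  rw [map_toCpInt_charIdeal_eq_of_finite_ker_coker ι hι M hM hf g hk hc]
  exact hN'

/-- **The heart shape transfers from the CM side to `Ch_Λ(M)`** along base change + a finite-kernel-finite-cokernel map
`N′ → N` (other direction). [cite: Washington1997, §13.2] [cite: StacksProject, Tag 02M1] -/
theorem heartShape_of_finite_ker_coker' (hM : Module.IsTorsion (IwasawaAlgebra p) M)
    {f : M →ₗ[IwasawaAlgebra p] N} (hf : IsBaseChange 𝒪⟦X⟧ f) (g' : N' →ₗ[𝒪⟦X⟧] N)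
    (hk : Finite (LinearMap.ker g')) (hc : Finite (N ⧸ LinearMap.range g')) {Q : PowerSeries 𝓞_ℂ_[p]}
    (hN' : ∃ m : ℕ, ∀ x ∈ (charIdeal 𝒪⟦X⟧ N').map (PowerSeries.map ι),
      (C ((p : ℕ) : 𝓞_ℂ_[p]) : PowerSeries 𝓞_ℂ_[p]) ^ m * x ∈ Ideal.span {Q}) :
    ∃ m : ℕ, ∀ x ∈ (charIdeal (IwasawaAlgebra p) M).map (PowerSeries.map (R1.toCpInt p)),
      (C ((p : ℕ) : 𝓞_ℂ_[p]) : PowerSeries 𝓞_ℂ_[p]) ^ m * x ∈ Ideal.span {Q} := by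
  rw [map_toCpInt_charIdeal_eq_of_finite_ker_coker' ι hι M hM hf g' hk hc]
  exact hN'

/-- **The heart shape transfers from the CM side to `Ch_Λ(M)`** along base change + a SURJECTION `N ↠ N′` (any kernel;
`N` finitely generated torsion). [cite: NeukirchSchmidtWingberg2008, Ch. V §3, Remark 2 after (5.3.9)] -/
theorem heartShape_of_surjective (hM : Module.IsTorsion (IwasawaAlgebra p) M)
    {f : M →ₗ[IwasawaAlgebra p] N} (hf : IsBaseChange 𝒪⟦X⟧ f) [Module.Finite 𝒪⟦X⟧ N]
    (hN : Module.IsTorsion 𝒪⟦X⟧ N) (g : N →ₗ[𝒪⟦X⟧] N') (hg : Function.Surjective g)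
    {Q : PowerSeries 𝓞_ℂ_[p]}
    (hN' : ∃ m : ℕ, ∀ x ∈ (charIdeal 𝒪⟦X⟧ N').map (PowerSeries.map ι),
      (C ((p : ℕ) : 𝓞_ℂ_[p]) : PowerSeries 𝓞_ℂ_[p]) ^ m * x ∈ Ideal.span {Q}) :
    ∃ m : ℕ, ∀ x ∈ (charIdeal (IwasawaAlgebra p) M).map (PowerSeries.map (R1.toCpInt p)),
      (C ((p : ℕ) : 𝓞_ℂ_[p]) : PowerSeries 𝓞_ℂ_[p]) ^ m * x ∈ Ideal.span {Q} :=
  heartShape_of_le (map_toCpInt_charIdeal_le_of_surjective ι hι M hM hf hN g hg) hN'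

end Reading

end Summit.BirchSwinnertonDyer.BirchSwinnertonDyer.Theorems.BiquadraticEisensteinDescentEisensteinHeartFlatCMInertBadKPrimeCharIdealBaseChange

end
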